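import Literature.AlgebraicGeometry.HodgeTheory.MaxRationalSubHodgeStructureFunctoriality
import HarnessLib

/-!
# Grothendieck 1969, p. 301: in degree `2p` and coniveau `p` the amended general Hodge conjecture
# IS the usual Hodge conjecture — rational classes in `Fʳ Hᵏ`, `max(2p, p) = span of Hodge classes`

Family `hodge`, layer `Literature/AlgebraicGeometry/HodgeTheory`; lane `lit-hodgefound` (Track 2 foundations,
Layer A1/A4). THEOREMS ONLY (no definition, no named fact; D-0026).

Grothendieck, *Hodge's general conjecture is false for trivial reasons*, Topology 8 (1969), p. 300: the
corrected left-hand side `Filt'ʳ Hᵏ` «should be the largest sub-space of [`Fʳ Hᵏ(X^an, ℂ) ∩ Hᵏ(X^an, ℚ)`],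
generating a subspace of `Hᵏ(X^an, ℂ)` which is a sub-Hodge structure»; p. 301: «For `i = 2p`, the
Hodge conjecture (which need in this case not be corrected) is just the usual Hodge conjecture,
characterizing algebraic cohomology classes.» Voisin 2025, §4.2: «the data of a Hodge class
`α ∈ H²ᵏ(X, ℚ)` is the same as the data of a Hodge substructure `ℚα ⊂ H²ᵏ(X, ℚ)` of Hodge coniveau `k`
(and of rank 1)». The tree has Grothendieck's largest subspace as `HodgeModel.maxRatSubHodgeInFilt A k r`
(`HodgeTheory/IntermediateJacobian`), the amended statement `GeneralHodgePropertyFor n X k r`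
(`GeneralHodgePropertyCMType`) and ONE direction of p. 301, `hodgeConjectureFor_of_generalHodgePropertyFor`
(`∀ p, GHC(X, 2p, p)` ⟹ `HC(X)`). This file proves the other direction and the identifications behind it:

* §1 RATIONAL CLASSES IN `Fʳ Hᵏ(X(ℂ); ℂ)` HAVE HODGE CONIVEAU `≥ r`: a rational class is real
  (`conj c = c`, `IsRationalClass.conjClass_eq`) and conjugation exchanges the type projectors
  (`HodgeModel.conjClass_typeProj`, Voisin I Cor. 6.12 `conj H^{p,q} = H^{q,p}`), while `c ∈ Fʳ` kills the
  components with `p < r` (`HodgeModel.typeProj_eq_zero_of_mem_hodgeFiltration`); so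
  `IsRationalClass.typeProj_eq_zero_of_mem_hodgeFiltrationBetti` (`π_{(p,q)} c = 0` for `p < r` OR `q < r`),
  `IsRationalClass.pullback_mem_hodgeConiveau_of_mem_hodgeFiltrationBetti`,
  **`IsRationalClass.eq_zero_of_mem_hodgeFiltrationBetti_of_lt`** (`k < 2r ⟹ c = 0`: `Fʳ Hᵏ ∩ Hᵏ(X, ℚ) = 0`)
  and **`IsRationalClass.isOfHodgeType_of_mem_hodgeFiltrationBetti`** (`k = 2p`, `r = p`: `c` is of type
  `(p, p)` — «`Hdg²ᵖ(X) = H²ᵖ(X, ℚ) ∩ Fᵖ H²ᵖ = H²ᵖ(X, ℚ) ∩ H^{p,p}`», Voisin I §11.3.1 / §7.1.1).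
* §2 THE LARGEST RATIONAL SUB-HODGE STRUCTURE IN `Fʳ Hᵏ`: `HodgeModel.span_isRationalClass_isOfHodgeType_mem_ratSubHodgeInFilt`
  (the span of the rational classes of a fixed type `(p, q)`, `p ≥ r`, is admissible; the tree's
  `span_singleton_mem_ratSubHodgeInFilt` is the rank-one case), **`HodgeModel.maxRatSubHodgeInFilt_eq_bot_of_lt`**
  (`k < 2r ⟹ max(k, r) = 0`) with `generalHodgePropertyFor_of_lt` (`GHC(X, k, r)` holds for `k < 2r`), and
  **`HodgeModel.maxRatSubHodgeInFilt_eq_span_of_add_self`**: for `p + p = k`,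
  `max(k, p) = span_ℂ {c | c rational of type (p, p)}` — a MODEL-FREE right-hand side (the Hodge classes).
* §3 **`generalHodgePropertyFor_two_mul_self_iff`** (`GHC(X, 2p, p) ↔` every rational `(p, p)`-class lies in
  `Nᵖ H²ᵖ(X(ℂ); ℂ) = algebraicClasses X p`), **`hodgeConjectureFor_iff_forall_generalHodgePropertyFor`**
  (`HC(X) ↔ ∀ p, GHC(X, 2p, p)`: Grothendieck p. 301 as an `↔`; Voisin 2025 Prop. 4.8's remark «The Hodge
  conjecture is a particular case of the generalized Hodge conjecture»), `hodgeConjectureFor_iff_forall_maxRatSubHodgeInFilt_le`.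
* §4 ALONG A SURJECTION `g : X ↠ W` of relative dimension `r` (with `MaxRationalSubHodgeStructureFunctoriality`):
  **`map_complexGysin_span_hodgeClasses_eq_of_surjective`** (`g_*` maps the span of the rational
  `(p + r, p + r)`-classes of `X` ONTO the span of the rational `(p, p)`-classes of `W`; elementwise this is the
  tree's `exists_isRationalClass_isOfHodgeType_complexGysin_eq_of_surjective`, Voisin 2025 Cor. 2.12) and
  `comap_complexBetti_map_span_hodgeClasses_eq_of_surjective` (`x` is a combination of Hodge classes iff `g^* x` is).

## References

* [GrothendieckTopology1969] A. Grothendieck, Hodge's general conjecture is false for trivial reasons,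
  Topology 8 (1969), pp. 299–301 (p. 300: the amended statement; p. 301: «for `i = 2p` … just the usual
  Hodge conjecture»).
* [VoisinHodgeI2002] C. Voisin, Hodge Theory and Complex Algebraic Geometry I, CUP 2002, §6.1.3 Cor. 6.12
  (`conj H^{p,q} = H^{q,p}`), Thm. 6.18, §7.1.1 (`H^{p,q} = Fᵖ ∩ conj F^q`), §7.3.2 Lemma 7.28 / Rem. 7.29,
  §11.3.1 (Hodge classes), §11.3 Conj. 11.37.
* [Voisin2025] C. Voisin, Hodge and generalized Hodge conjectures, coniveau and algebraic cycles, J. Open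
  Math. Probl. 1 (2025), Def. 2.4 (Hodge coniveau), §2.3, Cor. 2.12, §4.2 with Prop. 4.8.
* [VoisinHodgeII2003] C. Voisin, Hodge Theory and Complex Algebraic Geometry II, CUP 2003, §8.2.1.
-/

noncomputable section

open CategoryTheory AlgebraicGeometry
open Literature.AlgebraicTopology.SingularHomology
open Literature.Geometry.Kaehler
open Literature.AlgebraicGeometry.Motives (IsSmoothProjective ComplexPoints)

namespace Literature.AlgebraicGeometry.HodgeTheory

variable {n m : ℕ} {X W : Motives.SchemeOver ℂ}

/-! ### §1 Rational classes in `Fʳ Hᵏ(X(ℂ); ℂ)` have Hodge coniveau `≥ r` -/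

/-- **Conjugation symmetry of the type components of a rational class**: for a rational (hence real,
`conj c = c`) class `c ∈ Hᵏ(X(ℂ); ℂ)`, if the component `π_{(p,q)} c` vanishes then so does
`π_{(q,p)} c` (`conj ∘ π_{(p,q)} = π_{(q,p)} ∘ conj`, `HodgeModel.conjClass_typeProj`).
[cite: VoisinHodgeI2002, §6.1.3 Cor. 6.12] -/
theorem IsRationalClass.typeProj_eq_zero_of_swap (hX : IsSmoothProjective n X) (A : HodgeModel n X)
    {k : ℕ} {c : complexBetti X k} (hc : IsRationalClass c) (pq qp : ↥(Finset.HasAntidiagonal.antidiagonal k))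
    (hqp : qp.1 = pq.1.swap) (h0 : A.typeProj k pq c = 0) : A.typeProj k qp c = 0 := by
  have h := A.conjClass_typeProj hX pq c qp hqp
  rwa [h0, conjClass_zero, hc.conjClass_eq, eq_comm] at h

/-- **A rational class in `Fʳ Hᵏ` has no component of type `(p, q)` with `p < r` or `q < r`**: for
`p < r` because `A^* c ∈ Fʳ = ⊕_{p ≥ r} H^{p,q}` (`HodgeModel.typeProj_eq_zero_of_mem_hodgeFiltration`), for
`q < r` by conjugation symmetry (`typeProj_eq_zero_of_swap`). [cite: VoisinHodgeI2002, §7.1.1 and §6.1.3 Cor. 6.12]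
[cite: Voisin2025, Def. 2.4] -/
theorem IsRationalClass.typeProj_eq_zero_of_mem_hodgeFiltrationBetti (hX : IsSmoothProjective n X)
    (A : HodgeModel n X) {k r : ℕ} {c : complexBetti X k} (hc : IsRationalClass c)
    (hF : c ∈ A.hodgeFiltrationBetti k r) (pq : ↥(Finset.HasAntidiagonal.antidiagonal k))
    (hpq : pq.1.1 < r ∨ pq.1.2 < r) : A.typeProj k pq c = 0 := by
  rcases hpq with h | h
  · exact A.typeProj_eq_zero_of_mem_hodgeFiltration (A.mem_hodgeFiltrationBetti.1 hF) pq h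
  · let qp : ↥(Finset.HasAntidiagonal.antidiagonal k) :=
      ⟨pq.1.swap, Finset.HasAntidiagonal.swap_mem_antidiagonal.2 pq.2⟩
    exact hc.typeProj_eq_zero_of_swap hX A qp pq (Prod.swap_swap _).symm
      (A.typeProj_eq_zero_of_mem_hodgeFiltration (A.mem_hodgeFiltrationBetti.1 hF) qp
        (show pq.1.2 < r from h))

/-- **A rational class in `Fʳ Hᵏ(X(ℂ); ℂ)` has Hodge coniveau `≥ r`**: its pull-back to the Hodge model
lies in `⊕_{p, q ≥ r} H^{p,q}` (`HodgeModel.hodgeConiveau`). [cite: VoisinHodgeI2002, §7.1.1 and Cor. 6.12]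
[cite: Voisin2025, Def. 2.4] [cite: GrothendieckTopology1969, p. 300] -/
theorem IsRationalClass.pullback_mem_hodgeConiveau_of_mem_hodgeFiltrationBetti
    (hX : IsSmoothProjective n X) (A : HodgeModel n X) {k r : ℕ} {c : complexBetti X k}
    (hc : IsRationalClass c) (hF : c ∈ A.hodgeFiltrationBetti k r) :
    A.pullback k c ∈ A.hodgeConiveau k r := by
  rw [← A.sum_typeProj k c, map_sum]
  refine Submodule.sum_mem _ fun pq _ ↦ ?_
  by_cases h : pq.1.1 < r ∨ pq.1.2 < r
  · rw [hc.typeProj_eq_zero_of_mem_hodgeFiltrationBetti hX A hF pq h, map_zero]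
    exact Submodule.zero_mem _
  · push Not at h
    exact A.hodgePQ_le_hodgeConiveau (Finset.HasAntidiagonal.mem_antidiagonal.1 pq.2) h.1 h.2
      ((A.mem_typePiece_iff pq _).1 (A.typeProj_mem k pq c))

/-- **`Fʳ Hᵏ(X(ℂ); ℂ) ∩ Hᵏ(X, ℚ) = 0` for `k < 2r`**: a rational class in `Fʳ Hᵏ` with `k < 2r` vanishes
(every type `(p, q)`, `p + q = k`, has `p < r` or `q < r`). [cite: VoisinHodgeI2002, §7.1.1 and Cor. 6.12]
[cite: GrothendieckTopology1969, p. 300] -/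
theorem IsRationalClass.eq_zero_of_mem_hodgeFiltrationBetti_of_lt (hX : IsSmoothProjective n X)
    (A : HodgeModel n X) {k r : ℕ} (hk : k < 2 * r) {c : complexBetti X k} (hc : IsRationalClass c)
    (hF : c ∈ A.hodgeFiltrationBetti k r) : c = 0 := by
  rw [← A.sum_typeProj k c]
  refine Finset.sum_eq_zero fun pq _ ↦ hc.typeProj_eq_zero_of_mem_hodgeFiltrationBetti hX A hF pq ?_
  have := Finset.HasAntidiagonal.mem_antidiagonal.1 pq.2
  omega

/-- **A rational class in `Fᵖ Hᵏ(X(ℂ); ℂ)`, `k = 2p`, is of Hodge type `(p, p)`** («Hodge classes»: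
`Hdg²ᵖ(X) = H²ᵖ(X, ℚ) ∩ H^{p,p}(X)`, and for a real class `∈ Fᵖ H²ᵖ` forces type `(p, p)` since
`H^{p,q} = Fᵖ ∩ conj F^q`): all components other than `π_{(p,p)} c` vanish by §1.
[cite: VoisinHodgeI2002, §7.1.1 and §11.3.1] [cite: Voisin2025, §4.2] -/
theorem IsRationalClass.isOfHodgeType_of_mem_hodgeFiltrationBetti (hX : IsSmoothProjective n X)
    (A : HodgeModel n X) {k p : ℕ} (hk : p + p = k) {c : complexBetti X k} (hc : IsRationalClass c)
    (hF : c ∈ A.hodgeFiltrationBetti k p) : IsOfHodgeType n X k p p c := by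
  classical
  let pp : ↥(Finset.HasAntidiagonal.antidiagonal k) := ⟨(p, p), Finset.HasAntidiagonal.mem_antidiagonal.2 hk⟩
  have hsum : A.typeProj k pp c = c := by
    conv_rhs => rw [← A.sum_typeProj k c]
    rw [Finset.sum_eq_single pp]
    · intro pq _ hne
      refine hc.typeProj_eq_zero_of_mem_hodgeFiltrationBetti hX A hF pq ?_
      have h1 := Finset.HasAntidiagonal.mem_antidiagonal.1 pq.2
      by_contra h
      push Not at h
      exact hne (Subtype.ext (Prod.ext (show pq.1.1 = p by omega) (show pq.1.2 = p by omega)))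
    · intro h
      exact absurd (Finset.mem_univ pp) h
  rw [← hsum]
  exact (A.mem_typePiece_iff_isOfHodgeType' hX pp _).1 (A.typeProj_mem k pp c)

/-- **For a rational class `c ∈ Hᵏ(X(ℂ); ℂ)`, `k = 2p`: `c` is of type `(p, p)` iff `c ∈ Fᵖ Hᵏ`.**
[cite: VoisinHodgeI2002, §7.1.1 and §11.3.1] [cite: Voisin2025, §4.2] -/
theorem isOfHodgeType_iff_mem_hodgeFiltrationBetti_of_isRationalClass (hX : IsSmoothProjective n X)
    (A : HodgeModel n X) {k p : ℕ} (hk : p + p = k) {c : complexBetti X k} (hc : IsRationalClass c) :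
    IsOfHodgeType n X k p p c ↔ c ∈ A.hodgeFiltrationBetti k p :=
  ⟨fun h ↦ A.mem_hodgeFiltrationBetti.2
      (A.hodgePQ_le_hodgeFiltration hk le_rfl ((isOfHodgeType_iff_mem_hodgePQ hX A c).1 h)),
    fun h ↦ hc.isOfHodgeType_of_mem_hodgeFiltrationBetti hX A hk h⟩

/-! ### §2 The largest rational sub-Hodge structure in `Fʳ Hᵏ`: vanishing for `k < 2r`, Hodge classes for `k = 2r` -/

/-- **The span of the rational classes of a fixed type `(p, q)`, `p + q = k`, `p ≥ r`, is an admissible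
subspace of `(Hᵏ, Fʳ)`**: rationally spanned, a sub-Hodge structure after pull-back (it lies in
`H^{p,q}`), inside `Fʳ` (`H^{p,q} ⊆ Fʳ` for `p ≥ r`). The rank-one case is the tree's
`HodgeModel.span_singleton_mem_ratSubHodgeInFilt`. [cite: VoisinHodgeI2002, §7.3.1 and §7.1.1]
[cite: Voisin2025, §4.2] -/
theorem HodgeModel.span_isRationalClass_isOfHodgeType_mem_ratSubHodgeInFilt (A : HodgeModel n X)
    (hX : IsSmoothProjective n X) {k p q r : ℕ} (hpq : p + q = k) (hr : r ≤ p) :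
    Submodule.span ℂ {c : complexBetti X k | IsRationalClass c ∧ IsOfHodgeType n X k p q c} ∈
      A.ratSubHodgeInFilt k r := by
  refine ⟨isRationallySpanned_span fun c hc ↦ hc.1, ?_, ?_⟩
  · rw [Submodule.map_span]
    refine (A.isSubHodge_iff_le k _).2
      (le_iSup_of_le p <| le_iSup_of_le q <| le_iSup_of_le hpq <| le_inf le_rfl ?_)
    refine Submodule.span_le.2 ?_
    rintro _ ⟨c, hc, rfl⟩
    exact (isOfHodgeType_iff_mem_hodgePQ hX A c).1 hc.2
  · exact Submodule.span_le.2 fun c hc ↦ A.mem_hodgeFiltrationBetti.2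
      (A.hodgePQ_le_hodgeFiltration hpq hr ((isOfHodgeType_iff_mem_hodgePQ hX A c).1 hc.2))

/-- **`max(k, r) = 0` for `k < 2r`**: Grothendieck's largest rational sub-Hodge structure in `Fʳ Hᵏ(X(ℂ); ℂ)`
vanishes below the middle (it is spanned by rational classes of `Fʳ Hᵏ`, which vanish by §1).
[cite: GrothendieckTopology1969, p. 300] [cite: VoisinHodgeI2002, §7.1.1 and Cor. 6.12] -/
theorem HodgeModel.maxRatSubHodgeInFilt_eq_bot_of_lt (A : HodgeModel n X) (hX : IsSmoothProjective n X)
    {k r : ℕ} (hk : k < 2 * r) : A.maxRatSubHodgeInFilt k r = ⊥ := by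
  have h := A.maxRatSubHodgeInFilt_mem k r
  refine eq_bot_iff.2 (((isRationallySpanned_iff_le _).1 h.1).trans (Submodule.span_le.2 ?_))
  rintro c ⟨hcW, hc⟩
  rw [SetLike.mem_coe, Submodule.mem_bot]
  exact hc.eq_zero_of_mem_hodgeFiltrationBetti_of_lt hX A hk (h.2.2 hcW)

/-- Every admissible subspace of `(Hᵏ, Fʳ)` with `k < 2r` is `0`. [cite: GrothendieckTopology1969, p. 300]
[cite: VoisinHodgeI2002, §7.1.1 and Cor. 6.12] -/
theorem HodgeModel.eq_bot_of_mem_ratSubHodgeInFilt_of_lt (A : HodgeModel n X)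
    (hX : IsSmoothProjective n X) {k r : ℕ} (hk : k < 2 * r) {W' : Submodule ℂ (complexBetti X k)}
    (hW' : W' ∈ A.ratSubHodgeInFilt k r) : W' = ⊥ :=
  eq_bot_iff.2 ((A.le_maxRatSubHodgeInFilt hW').trans (A.maxRatSubHodgeInFilt_eq_bot_of_lt hX hk).le)

/-- **`GHC(X, k, r)` holds (trivially) for `k < 2r`**: there is nothing to support.
[cite: GrothendieckTopology1969, p. 300] [cite: VoisinHodgeI2002, §11.3 Conj. 11.37] -/
theorem generalHodgePropertyFor_of_lt (A : HodgeModel n X) (hX : IsSmoothProjective n X) {k r : ℕ}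
    (hk : k < 2 * r) : GeneralHodgePropertyFor n X k r :=
  (generalHodgePropertyFor_iff_of_hodgeModel A hX k r).2
    (by rw [A.maxRatSubHodgeInFilt_eq_bot_of_lt hX hk]; exact bot_le)

/-- **`max(k, p) = span of the Hodge classes` for `k = 2p`**: Grothendieck's largest rational sub-Hodge
structure of `Hᵏ(X(ℂ); ℂ)` contained in `Fᵖ` is the complex span of the rational classes of type `(p, p)`
— a model-free description (`IsOfHodgeType` quantifies over models existentially). `≥`: that span is
admissible (§2); `≤`: `max` is spanned by its rational classes, which lie in `Fᵖ`, hence are of type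
`(p, p)` (§1). [cite: GrothendieckTopology1969, pp. 300–301] [cite: Voisin2025, §4.2]
[cite: VoisinHodgeI2002, §11.3.1 and §7.1.1] -/
theorem HodgeModel.maxRatSubHodgeInFilt_eq_span_of_add_self (A : HodgeModel n X)
    (hX : IsSmoothProjective n X) {k p : ℕ} (hk : p + p = k) :
    A.maxRatSubHodgeInFilt k p =
      Submodule.span ℂ {c : complexBetti X k | IsRationalClass c ∧ IsOfHodgeType n X k p p c} := by
  refine le_antisymm ?_ (A.le_maxRatSubHodgeInFilt
    (A.span_isRationalClass_isOfHodgeType_mem_ratSubHodgeInFilt hX hk le_rfl))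
  have h := A.maxRatSubHodgeInFilt_mem k p
  refine ((isRationallySpanned_iff_le _).1 h.1).trans (Submodule.span_mono ?_)
  rintro c ⟨hcW, hc⟩
  exact ⟨hc, hc.isOfHodgeType_of_mem_hodgeFiltrationBetti hX A hk (h.2.2 hcW)⟩

/-- The same in the spelling `(2p, p)` of `hodgeConjectureFor_of_generalHodgePropertyFor`.
[cite: GrothendieckTopology1969, pp. 300–301] [cite: Voisin2025, §4.2] -/
theorem HodgeModel.maxRatSubHodgeInFilt_two_mul_self_eq_span (A : HodgeModel n X)
    (hX : IsSmoothProjective n X) (p : ℕ) :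
    A.maxRatSubHodgeInFilt (2 * p) p =
      Submodule.span ℂ {c : complexBetti X (2 * p) | IsRationalClass c ∧ IsOfHodgeType n X (2 * p) p p c} :=
  A.maxRatSubHodgeInFilt_eq_span_of_add_self hX (two_mul p).symm

/-- **Every admissible subspace of `(Hᵏ, Fᵖ)`, `k = 2p`, is spanned inside the Hodge classes.**
[cite: GrothendieckTopology1969, p. 301] [cite: Voisin2025, §4.2] -/
theorem HodgeModel.le_span_of_mem_ratSubHodgeInFilt_of_add_self (A : HodgeModel n X)
    (hX : IsSmoothProjective n X) {k p : ℕ} (hk : p + p = k) {W' : Submodule ℂ (complexBetti X k)}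
    (hW' : W' ∈ A.ratSubHodgeInFilt k p) :
    W' ≤ Submodule.span ℂ {c : complexBetti X k | IsRationalClass c ∧ IsOfHodgeType n X k p p c} :=
  (A.le_maxRatSubHodgeInFilt hW').trans (A.maxRatSubHodgeInFilt_eq_span_of_add_self hX hk).le

/-! ### §3 `GHC(X, 2p, p) ↔ HC(X)` in degree `2p`; `HC(X) ↔ ∀ p, GHC(X, 2p, p)` -/

/-- **`GHC(X, k, p)`, `k = 2p`, iff every rational `(p, p)`-class of degree `k` is supported in codimension
`p`** (one Hodge model `A` given; `max(k, p) = span of Hodge classes` and `span S ≤ N ↔ S ⊆ N`).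
[cite: GrothendieckTopology1969, p. 301] [cite: Voisin2025, §4.2 and Prop. 4.8] -/
theorem generalHodgePropertyFor_iff_forall_isRationalClass_of_add_self (A : HodgeModel n X)
    (hX : IsSmoothProjective n X) {k p : ℕ} (hk : p + p = k) :
    GeneralHodgePropertyFor n X k p ↔
      ∀ c : complexBetti X k, IsRationalClass c → IsOfHodgeType n X k p p c →
        c ∈ supportedClasses X k p := by
  rw [generalHodgePropertyFor_iff_of_hodgeModel A hX, A.maxRatSubHodgeInFilt_eq_span_of_add_self hX hk,
    Submodule.span_le]
  exact ⟨fun h c hc hT ↦ h ⟨hc, hT⟩, fun h c hc ↦ h c hc.1 hc.2⟩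

/-- **GROTHENDIECK, p. 301: `GHC(X, 2p, p)` IS THE HODGE CONJECTURE FOR `X` IN DEGREE `2p`** — every
rational class of type `(p, p)` lies in `Nᵖ H²ᵖ(X(ℂ); ℂ) = algebraicClasses X p` («for `i = 2p`, the Hodge
conjecture (which need in this case not be corrected) is just the usual Hodge conjecture, characterizing
algebraic cohomology classes»). [cite: GrothendieckTopology1969, p. 301] [cite: Voisin2025, §4.2 and Prop. 4.8]
[cite: VoisinHodgeI2002, §11.3 Conj. 11.37 and §11.3.1] -/
theorem generalHodgePropertyFor_two_mul_self_iff (A : HodgeModel n X) (hX : IsSmoothProjective n X)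
    (p : ℕ) :
    GeneralHodgePropertyFor n X (2 * p) p ↔
      ∀ c : complexBetti X (2 * p), IsRationalClass c → IsOfHodgeType n X (2 * p) p p c →
        c ∈ algebraicClasses X p :=
  generalHodgePropertyFor_iff_forall_isRationalClass_of_add_self A hX (two_mul p).symm

/-- **`HC(X) ⟹ GHC(X, 2p, p)` for every `p`** (the direction of Grothendieck's p. 301 remark that the tree
lacked; the converse is `hodgeConjectureFor_of_generalHodgePropertyFor`). [cite: GrothendieckTopology1969, p. 301]
[cite: Voisin2025, §4.2 and Prop. 4.8] -/
theorem generalHodgePropertyFor_two_mul_self_of_hodgeConjectureFor (hX : IsSmoothProjective n X)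
    (h : HodgeConjectureFor n X) (p : ℕ) : GeneralHodgePropertyFor n X (2 * p) p := by
  obtain ⟨⟨A⟩, hH⟩ := h
  exact (generalHodgePropertyFor_two_mul_self_iff A hX p).2 (hH p)

/-- **THE HODGE CONJECTURE FOR `X` ⟺ GROTHENDIECK'S AMENDED GENERAL HODGE CONJECTURE FOR `X` IN ALL THE
DEGREES `(2p, p)`** (Grothendieck 1969, p. 301, as an equivalence on the tree's carriers).
[cite: GrothendieckTopology1969, p. 301] [cite: Voisin2025, §4.2 and Prop. 4.8]
[cite: VoisinHodgeI2002, §11.3 Conj. 11.37] -/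
theorem hodgeConjectureFor_iff_forall_generalHodgePropertyFor (hX : IsSmoothProjective n X) :
    HodgeConjectureFor n X ↔ ∀ p : ℕ, GeneralHodgePropertyFor n X (2 * p) p :=
  ⟨generalHodgePropertyFor_two_mul_self_of_hodgeConjectureFor hX,
    hodgeConjectureFor_of_generalHodgePropertyFor⟩

/-- **`HC(X)` iff, in one Hodge model `A`, `max(2p, p) ≤ Nᵖ H²ᵖ(X(ℂ); ℂ)` for all `p`** (Grothendieck's
«largest sub-Hodge structure in `Fᵖ`» lies in the algebraic classes). [cite: GrothendieckTopology1969, pp. 300–301] -/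
theorem hodgeConjectureFor_iff_forall_maxRatSubHodgeInFilt_le (A : HodgeModel n X)
    (hX : IsSmoothProjective n X) :
    HodgeConjectureFor n X ↔ ∀ p : ℕ, A.maxRatSubHodgeInFilt (2 * p) p ≤ algebraicClasses X p := by
  rw [hodgeConjectureFor_iff_forall_generalHodgePropertyFor hX]
  exact forall_congr' fun p ↦ generalHodgePropertyFor_iff_of_hodgeModel A hX (2 * p) p

/-! ### §4 Along a surjection: the spans of Hodge classes correspond under `g_*` and `g^*` -/

section Surjective

/-- **`g_*` MAPS THE SPAN OF THE RATIONAL `(p + r, p + r)`-CLASSES OF `X` ONTO THE SPAN OF THE RATIONAL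
`(p, p)`-CLASSES OF `W`** along a surjection `g : X ↠ W` of relative dimension `r` (the Gysin image of
Grothendieck's `max_X(2p + 2r, p + r)` is `max_W(2p, p)`, `HodgeModel.map_complexGysin_maxRatSubHodgeInFilt_eq`,
and both are spans of Hodge classes, §2; elementwise: the tree's
`exists_isRationalClass_isOfHodgeType_complexGysin_eq_of_surjective`). [cite: Voisin2025, Cor. 2.12 and §2.3]
[cite: VoisinHodgeI2002, §7.3.2 Lemma 7.28, Remark 7.29 and Lemma 7.30] [cite: GrothendieckTopology1969, pp. 300–301] -/
theorem map_complexGysin_span_hodgeClasses_eq_of_surjective (hX : IsSmoothProjective n X)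
    (hW : IsSmoothProjective m W) (g : X ⟶ W) [Surjective g.left] {r : ℕ} (hr : m + r = n) (p : ℕ) :
    (Submodule.span ℂ {c : complexBetti X (2 * p + 2 * r) |
        IsRationalClass c ∧ IsOfHodgeType n X (2 * p + 2 * r) (p + r) (p + r) c}).map
        (complexGysin complexOrientationFamily hX hW g
          (show (2 * p + 2 * r) + 2 * m = 2 * p + 2 * n by omega)) =
      Submodule.span ℂ {c : complexBetti W (2 * p) | IsRationalClass c ∧ IsOfHodgeType m W (2 * p) p p c} := by
  obtain ⟨B⟩ := nonempty_hodgeModel_holds (n := n) (X := X) hX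
  obtain ⟨A⟩ := nonempty_hodgeModel_holds (n := m) (X := W) hW
  rw [← B.maxRatSubHodgeInFilt_eq_span_of_add_self hX (show (p + r) + (p + r) = 2 * p + 2 * r by omega),
    ← A.maxRatSubHodgeInFilt_eq_span_of_add_self hW (show p + p = 2 * p by omega)]
  exact B.map_complexGysin_maxRatSubHodgeInFilt_eq A hX hW g hr (2 * p) p

/-- **`x ∈ Hᵏ(W(ℂ); ℂ)`, `k = 2p`, is a combination of Hodge classes iff `g^* x` is**, along a surjection
`g : X ↠ W` (`(g^*)⁻¹(max_X(k, p)) = max_W(k, p)`, `HodgeModel.comap_complexBetti_map_maxRatSubHodgeInFilt_eq`).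
[cite: VoisinHodgeI2002, §7.3.2 Lemma 7.28 and Remark 7.29] [cite: GrothendieckTopology1969, pp. 300–301] -/
theorem comap_complexBetti_map_span_hodgeClasses_eq_of_surjective (hW : IsSmoothProjective m W)
    (hX : IsSmoothProjective n X) (g : X ⟶ W) [Surjective g.left] {k p : ℕ} (hk : p + p = k) :
    (Submodule.span ℂ {c : complexBetti X k | IsRationalClass c ∧ IsOfHodgeType n X k p p c}).comap
        (complexBetti.map g k).hom =
      Submodule.span ℂ {c : complexBetti W k | IsRationalClass c ∧ IsOfHodgeType m W k p p c} := by
  obtain ⟨B⟩ := nonempty_hodgeModel_holds (n := n) (X := X) hX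
  obtain ⟨A⟩ := nonempty_hodgeModel_holds (n := m) (X := W) hW
  rw [← B.maxRatSubHodgeInFilt_eq_span_of_add_self hX hk, ← A.maxRatSubHodgeInFilt_eq_span_of_add_self hW hk]
  exact A.comap_complexBetti_map_maxRatSubHodgeInFilt_eq B hW hX g k p

end Surjective

end Literature.AlgebraicGeometry.HodgeTheory

end
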